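import Summits.CriticalPhenomena.SAWScalingLimit.Theorems.SAWDefectDecoherenceBoundaryClosureRGateDbarLimit
import Summits.CriticalPhenomena.SAWScalingLimit.Theorems.SAWDefectDecoherenceDefectDecoherenceSsStarMassHarnackAux1
import Summits.CriticalPhenomena.SAWScalingLimit.Theorems.MassRatio.Negative.Walks
import Literature.Probability.Percolation.TriDiscreteDomain
import Literature.Analysis.Complex.HeightAveraging
import HarnessLib

/-!
# Polygon Green pairing, I: metric depth layers, star masses, dangling masses
(crux `BoundaryClosureR`, stmt-CriticalPhenomena-14004, line `polygon-parity-squeeze`, registered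
stub `polygonGreenPairing`, mechanism (A1a))

Lattice bookkeeping for the discrete Green pairing with explicit boundary dart term
(`…PolygonGreenPairing.lean`), the analogue for a GENERAL admissible pinned family of the gate case
`…GateDbarLayers.lean` (rows above the gate ↦ METRIC DEPTH `IsMetricDepth`):
* `isMetricDepth_zero_of_dart`, `exists_isMetricDepth`, `isMetricDepth_unique`,
  `mul_le_of_isMetricDepth` — every vertex of a finite `Λ` has exactly one metric depth; the inner
  endpoint of a boundary dart has depth `0`; depths are `O(diam/δ)` in a bounded domain;
* `layerCake_depth_le` — a vertex functional dominated at depth `k` by `w(k)·starMass` sums, over the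
  vertices with scaled centre in a budget ball, to at most `C_B Z_b Σ_{k ≤ K} w(k)(k+1)^{3/4}`
  (the boundary layer budget `BoundaryLayerBudgetAt`, layer by layer; registered form
  `polygonGreen_layerCake`);
* `sum_starMass_le_two_mul_finsum` — star masses versus the `σ = 0` mass of the nearby mid-edges (the
  form consumed by `MassRatio`); `sum_filter_le_of_cover` — splitting a vertex sum along a cover;
* `norm_obs_zero_dart_le` — the DANGLING MASS BOUND `Z({v,t}) ≤ x_c · starMass(v)` at a boundary dart
  `v → t ∉ Λ` off the root vertex (a walk to `{v,t}` arrives at `v` through an inner mid-edge of the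
  star of `v`; drop its last vertex).
References: Duminil-Copin–Smirnov, Ann. of Math. 175 (2012), §2–§3; Lawler–Schramm–Werner (2004),
§3.4 (layer budgets).  Everything here is proved.
-/

noncomputable section

open scoped BigOperators Topology Classical
open Filter Set Metric
open Literature.Probability.LatticeModels Literature.Probability.RandomPlanarGeometry
open Literature.Probability.RandomPlanarGeometry.SAW
open Literature.Barriers.CriticalPhenomena.HexGreen (nbrs mem_nbrs_iff)
open Literature.Probability.Percolation (hexCenter_injective)
open Summit.CriticalPhenomena.SAWScalingLimit.Theorems.ObservableToSLE.FloorRatio (dist_smul_mesh)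
open Summit.CriticalPhenomena.SAWScalingLimit.Theorems.DecoherenceSynthesis (norm_hexMidpoint_sub_hexCenter_le)
open Summit.CriticalPhenomena.SAWScalingLimit.Cruxes.DefectDecoherence.TipMartingaleDepthInduction.WallExitTwoPoint
  (dist_hexCenter_le_one_of_adj)
open Summit.CriticalPhenomena.SAWScalingLimit.Theorems.MassRatio.Negative (hexDomainMidEdges_finite
  norm_Z_eq_sum)
open Summit.CriticalPhenomena.SAWScalingLimit.Theorems.DefectDecoherence.SectorSlaving (har_exists_cut)
open Literature.Analysis.Complex.HeightAvg (sum_biUnion_le_sum_sum)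

namespace Summit.CriticalPhenomena.SAWScalingLimit.Theorems.PolygonParitySqueeze.PolygonGreen

/-! ### 0. A union bound -/

/-- `Σ_{A ∪ B} f ≤ Σ_A f + Σ_B f` for non-negative summands. [folklore] -/
theorem sum_union_le_add {α : Type*} [DecidableEq α] (A B : Finset α) (f : α → ℝ) (hf : ∀ a, 0 ≤ f a) :
    ∑ a ∈ A ∪ B, f a ≤ ∑ a ∈ A, f a + ∑ a ∈ B, f a := by
  have h := Finset.sum_union_inter (s₁ := A) (s₂ := B) (f := f)
  have h0 : 0 ≤ ∑ a ∈ A ∩ B, f a := Finset.sum_nonneg fun a _ ↦ hf a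
  linarith

/-! ### 1. Metric depth -/

/-- **The inner endpoint of a boundary dart has metric depth `0`**: `v ∈ Λ`, `t ∼ v`, `t ∉ Λ`
(centres determine faces; adjacent centres are at distance `≤ 1`). [folklore] -/
theorem isMetricDepth_zero_of_dart {Λ : Finset HexVertex} {v t : HexVertex} (hv : v ∈ Λ)
    (hvt : hexGraph.Adj v t) (ht : t ∉ Λ) : IsMetricDepth Λ v 0 := by
  refine ⟨fun y hy => ?_, fun h => ht (h t ?_)⟩
  · have h0 : dist (hexCenter y) (hexCenter v) = 0 := le_antisymm (by exact_mod_cast hy) dist_nonneg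
    rw [hexCenter_injective (dist_eq_zero.1 h0)]; exact hv
  · push_cast; rw [zero_add]; exact dist_hexCenter_le_one_of_adj hvt

/-- A vertex of metric depth `k` is `k`-deep. [folklore] -/
theorem deep_of_isMetricDepth {Λ : Finset HexVertex} {v : HexVertex} {k : ℕ} (h : IsMetricDepth Λ v k) :
    ∀ y : HexVertex, dist (hexCenter y) (hexCenter v) ≤ k → y ∈ Λ := h.1

/-- An `R`-deep vertex with `R ≥ 1` does not have metric depth `0`. [folklore] -/
theorem not_isMetricDepth_zero_of_deep {Λ : Finset HexVertex} {v : HexVertex} {R : ℝ} (hR : 1 ≤ R)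
    (hdeep : ∀ y : HexVertex, dist (hexCenter y) (hexCenter v) ≤ R → y ∈ Λ) : ¬ IsMetricDepth Λ v 0 := by
  rintro ⟨-, h⟩
  refine h fun y hy => hdeep y (hy.trans ?_)
  push_cast; linarith

/-- **Every vertex of a finite `Λ` has a metric depth** (the lattice is infinite). [folklore] -/
theorem exists_isMetricDepth {Λ : Finset HexVertex} {v : HexVertex} (hv : v ∈ Λ) : ∃ k : ℕ, IsMetricDepth Λ v k := by
  classical
  obtain ⟨y, hy⟩ := Infinite.exists_notMem_finset Λ
  -- some radius fails
  have hex : ∃ k : ℕ, ¬ (∀ y' : HexVertex, dist (hexCenter y') (hexCenter v) ≤ (k : ℝ) → y' ∈ Λ) := by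
    refine ⟨⌈dist (hexCenter y) (hexCenter v)⌉₊, fun h => hy (h y (Nat.le_ceil _))⟩
  set k₀ := Nat.find hex with hk₀
  have hk₀spec : ¬ (∀ y' : HexVertex, dist (hexCenter y') (hexCenter v) ≤ (k₀ : ℝ) → y' ∈ Λ) := Nat.find_spec hex
  have hk₀pos : 0 < k₀ := by
    rw [hk₀, Nat.find_pos]
    push Not
    intro y' hy'
    have h0 : dist (hexCenter y') (hexCenter v) = 0 := le_antisymm (by exact_mod_cast hy') dist_nonneg
    rw [hexCenter_injective (dist_eq_zero.1 h0)]; exact hv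
  refine ⟨k₀ - 1, by simpa using Nat.find_min hex (show k₀ - 1 < Nat.find hex by omega), ?_⟩
  · have e : ((k₀ - 1 : ℕ) : ℝ) + 1 = (k₀ : ℝ) := by
      rw [Nat.cast_sub (by omega)]; push_cast; ring
    rw [e]; exact hk₀spec

/-- **Metric depth is unique.** [folklore] -/
theorem isMetricDepth_unique {Λ : Finset HexVertex} {v : HexVertex} {k k' : ℕ} (h : IsMetricDepth Λ v k)
    (h' : IsMetricDepth Λ v k') : k = k' := by
  by_contra hne
  wlog hlt : k < k' generalizing k k'
  · exact this h' h (Ne.symm hne) (lt_of_le_of_ne (not_lt.1 hlt) (Ne.symm hne))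
  have hle : (k : ℝ) + 1 ≤ k' := by exact_mod_cast Nat.succ_le_of_lt hlt
  exact h.2 fun y hy => h'.1 y (hy.trans hle)

/-- Shifting a face by `k` cells to the right moves its centre by `k`. [folklore] -/
theorem hexCenter_shift (v : HexVertex) (k : ℤ) :
    hexCenter ((v.1 + Pi.single 0 k, v.2) : HexVertex) = hexCenter v + (k : ℂ) := by
  simp only [hexCenter, triEmbed_add]
  have h : triEmbed (Pi.single 0 k : Site 2) = (k : ℂ) := by
    simp [triEmbed]
  rw [h]; ring

/-- **Depths are `O(diam/δ)`.** If the `δ`-scaled centres of the faces of `Λ` have norm `≤ R₀`, a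
vertex of metric depth `k` satisfies `δ k ≤ 2 R₀` (the face `k` cells to its right is still in `Λ`).
[folklore] -/
theorem mul_le_of_isMetricDepth {Λ : Finset HexVertex} {δ R₀ : ℝ} (hδ : 0 ≤ δ)
    (hΛ : ∀ y ∈ Λ, ‖(δ : ℂ) * hexCenter y‖ ≤ R₀) {v : HexVertex} {k : ℕ} (h : IsMetricDepth Λ v k) :
    δ * (k : ℝ) ≤ 2 * R₀ := by
  set y : HexVertex := (v.1 + Pi.single 0 (k : ℤ), v.2) with hy
  have hcy : hexCenter y = hexCenter v + (k : ℂ) := by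
    rw [hy, hexCenter_shift]; norm_cast
  have hdist : dist (hexCenter y) (hexCenter v) ≤ k := by
    rw [dist_eq_norm, hcy, add_sub_cancel_left]
    simp
  have h1 := hΛ y (h.1 y hdist)
  have h2 := hΛ v (h.1 v (by simp))
  have hdiff : ‖(δ : ℂ) * hexCenter y - (δ : ℂ) * hexCenter v‖ = δ * k := by
    rw [← mul_sub, hcy, add_sub_cancel_left, norm_mul, Complex.norm_real, Real.norm_of_nonneg hδ]
    simp
  have := norm_sub_le ((δ : ℂ) * hexCenter y) ((δ : ℂ) * hexCenter v)
  linarith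

/-! ### 2. The layer cake over a budget ball -/

/-- **Layer cake by metric depth.** Suppose the LAYER BUDGET at mesh `δ` on the ball `B(z, r)`:
`δ Σ_{v ∈ Λ, δ c_v ∈ B(z,r), depth v = k} starMass ≤ C_B (k+1)^{3/4} Z_b` for every `k`, that every
vertex of `Λ` has metric depth `≤ K`, and that the non-negative vertex functional `Φ` is dominated at
depth `k` by `w(k) · starMass` with non-negative weights `w`.  Then
`δ Σ_{v ∈ Λ, δ c_v ∈ B(z,r)} Φ(v) ≤ C_B Z_b Σ_{k ≤ K} w(k) (k+1)^{3/4}`.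
[cite: LawlerSchrammWerner2004SAW, §3.4 (restriction / boundary scaling heuristics)] -/
theorem layerCake_depth_le {Λ : Finset HexVertex} {a : Sym2 HexVertex} {δ r CB Zb : ℝ} {z : ℂ}
    (hδ : 0 ≤ δ)
    (hbudget : ∀ k : ℕ, δ * (∑ᶠ v ∈ {v : HexVertex | v ∈ Λ ∧ (δ : ℂ) * hexCenter v ∈ ball z r ∧
        IsMetricDepth Λ v k}, starMass Λ a v) ≤ CB * ((k : ℝ) + 1) ^ (3 / 4 : ℝ) * Zb)
    {K : ℕ} (hK : ∀ v ∈ Λ, ∀ k : ℕ, IsMetricDepth Λ v k → k ≤ K)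
    (w : ℕ → ℝ) (hw : ∀ k, 0 ≤ w k) (Φ : HexVertex → ℝ)
    (hΦ : ∀ v ∈ Λ, ∀ k : ℕ, IsMetricDepth Λ v k → Φ v ≤ w k * starMass Λ a v) :
    δ * ∑ v ∈ Λ.filter (fun v => (δ : ℂ) * hexCenter v ∈ ball z r), Φ v ≤
      CB * Zb * ∑ k ∈ Finset.range (K + 1), w k * ((k : ℝ) + 1) ^ (3 / 4 : ℝ) := by
  classical
  set S := Λ.filter (fun v => (δ : ℂ) * hexCenter v ∈ ball z r) with hS
  -- the depth function
  set g : HexVertex → ℕ := fun v => if h : v ∈ Λ then Nat.find (exists_isMetricDepth h) else 0 with hg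
  have hgspec : ∀ v ∈ Λ, IsMetricDepth Λ v (g v) := fun v hv => by
    simp only [hg, dif_pos hv]; exact Nat.find_spec (exists_isMetricDepth hv)
  have hmaps : ∀ v ∈ S, g v ∈ Finset.range (K + 1) := fun v hv => by
    have hvΛ := (Finset.mem_filter.1 hv).1
    exact Finset.mem_range.2 (Nat.lt_succ_of_le (hK v hvΛ _ (hgspec v hvΛ)))
  -- dominate `Φ` by the depth weights
  have hdom : ∑ v ∈ S, Φ v ≤ ∑ v ∈ S, w (g v) * starMass Λ a v :=
    Finset.sum_le_sum fun v hv => hΦ v (Finset.mem_filter.1 hv).1 _ (hgspec v (Finset.mem_filter.1 hv).1)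
  -- the fibres are the depth layers
  have hfib : ∀ k : ℕ, ∑ v ∈ S.filter (fun v => g v = k), w (g v) * starMass Λ a v =
      w k * ∑ᶠ v ∈ {v : HexVertex | v ∈ Λ ∧ (δ : ℂ) * hexCenter v ∈ ball z r ∧ IsMetricDepth Λ v k},
        starMass Λ a v := by
    intro k
    have hset : (↑(S.filter (fun v => g v = k)) : Set HexVertex) =
        {v : HexVertex | v ∈ Λ ∧ (δ : ℂ) * hexCenter v ∈ ball z r ∧ IsMetricDepth Λ v k} := by
      ext v
      simp only [Finset.coe_filter, Set.mem_setOf_eq, hS, Finset.mem_filter]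
      constructor
      · rintro ⟨⟨hvΛ, hvb⟩, hgv⟩
        exact ⟨hvΛ, hvb, hgv ▸ hgspec v hvΛ⟩
      · rintro ⟨hvΛ, hvb, hk⟩
        exact ⟨⟨hvΛ, hvb⟩, isMetricDepth_unique (hgspec v hvΛ) hk⟩
    rw [← hset, finsum_mem_coe_finset, Finset.mul_sum]
    refine Finset.sum_congr rfl fun v hv => ?_
    rw [(Finset.mem_filter.1 hv).2]
  calc δ * ∑ v ∈ S, Φ v ≤ δ * ∑ v ∈ S, w (g v) * starMass Λ a v := mul_le_mul_of_nonneg_left hdom hδ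
    _ = δ * ∑ k ∈ Finset.range (K + 1), ∑ v ∈ S.filter (fun v => g v = k), w (g v) * starMass Λ a v := by
        rw [Finset.sum_fiberwise_of_maps_to hmaps]
    _ = ∑ k ∈ Finset.range (K + 1), w k * (δ * ∑ᶠ v ∈ {v : HexVertex | v ∈ Λ ∧
          (δ : ℂ) * hexCenter v ∈ ball z r ∧ IsMetricDepth Λ v k}, starMass Λ a v) := by
        rw [Finset.mul_sum]
        exact Finset.sum_congr rfl fun k _ => by rw [hfib k]; ring
    _ ≤ ∑ k ∈ Finset.range (K + 1), w k * (CB * ((k : ℝ) + 1) ^ (3 / 4 : ℝ) * Zb) :=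
        Finset.sum_le_sum fun k _ => mul_le_mul_of_nonneg_left (hbudget k) (hw k)
    _ = CB * Zb * ∑ k ∈ Finset.range (K + 1), w k * ((k : ℝ) + 1) ^ (3 / 4 : ℝ) := by
        rw [Finset.mul_sum]; exact Finset.sum_congr rfl fun k _ => by ring

/-! ### 3. Star masses versus the mass of nearby mid-edges -/

/-- The three neighbours: `#((nbrs v).filter p) ≤ 3`. [folklore] -/
theorem card_filter_nbrs_le (v : HexVertex) (p : HexVertex → Prop) [DecidablePred p] :
    ((nbrs v).filter p).card ≤ 3 := by
  refine (Finset.card_filter_le _ _).trans ?_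
  unfold nbrs
  split_ifs <;> exact Finset.card_le_three

/-- The inner star at `v` written with `nbrs`. [folklore] -/
theorem filter_adj_eq_filter_nbrs (Λ : Finset HexVertex) (v : HexVertex) :
    Λ.filter (fun t => hexGraph.Adj v t) = (nbrs v).filter (· ∈ Λ) := by
  ext t
  simp only [Finset.mem_filter, mem_nbrs_iff]
  tauto

/-- **Star masses versus mid-edge masses.** If every inner star edge at a vertex of `Λ` satisfying
`P` has its scaled midpoint in `K`, then `Σ_{v ∈ Λ, P v} starMass(v) ≤ 2 Σᶠ_{z ∈ Ω(Λ), δ·mid z ∈ K} Z(z)`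
(an interior edge lies in the stars of its two endpoints). [cite: DuminilCopinSmirnov2012, Def. 1 (σ = 0)] -/
theorem sum_starMass_le_two_mul_finsum (Λ : Finset HexVertex) (a : Sym2 HexVertex) (δ : ℝ)
    (P : HexVertex → Prop) [DecidablePred P] (K : Set ℂ)
    (hPK : ∀ v ∈ Λ, P v → ∀ t ∈ Λ, hexGraph.Adj v t → (δ : ℂ) * hexMidpoint s(v, t) ∈ K) :
    ∑ v ∈ Λ.filter P, starMass Λ a v ≤
      2 * ∑ᶠ z ∈ {z : Sym2 HexVertex | z ∈ hexDomainMidEdges Λ ∧ (δ : ℂ) * hexMidpoint z ∈ K},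
        ‖hexParafermionicObservable Λ a hexCriticalFugacity 0 z‖ := by
  classical
  set Z := hexParafermionicObservable Λ a hexCriticalFugacity 0 with hZ
  set g : Sym2 HexVertex → ℝ := fun z => if (δ : ℂ) * hexMidpoint z ∈ K then ‖Z z‖ else 0 with hg
  have hg0 : ∀ z, 0 ≤ g z := fun z => by simp only [hg]; split_ifs <;> positivity
  -- (1) dominate the restricted star sum by the symmetric indicator sum over all ordered pairs
  have h1 : ∑ v ∈ Λ.filter P, starMass Λ a v ≤
      ∑ v ∈ Λ, ∑ t ∈ Λ.filter (fun t => hexGraph.Adj v t), g s(v, t) := by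
    calc ∑ v ∈ Λ.filter P, starMass Λ a v
        = ∑ v ∈ Λ.filter P, ∑ t ∈ Λ.filter (fun t => hexGraph.Adj v t), g s(v, t) := by
          refine Finset.sum_congr rfl fun v hv => ?_
          obtain ⟨hvΛ, hPv⟩ := Finset.mem_filter.1 hv
          rw [starMass]
          refine Finset.sum_congr rfl fun t ht => ?_
          obtain ⟨htΛ, hadj⟩ := Finset.mem_filter.1 ht
          simp only [hg, if_pos (hPK v hvΛ hPv t htΛ hadj), hZ]
      _ ≤ ∑ v ∈ Λ, ∑ t ∈ Λ.filter (fun t => hexGraph.Adj v t), g s(v, t) :=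
          Finset.sum_le_sum_of_subset_of_nonneg (Finset.filter_subset _ _)
            fun v _ _ => Finset.sum_nonneg fun t _ => hg0 _
  -- (2) symmetrise: each interior edge appears twice
  have h2 : ∑ v ∈ Λ, ∑ t ∈ Λ.filter (fun t => hexGraph.Adj v t), g s(v, t) =
      2 * ∑ v ∈ Λ.filter (fun v => v.2 = 0), ∑ t ∈ Λ.filter (fun t => hexGraph.Adj v t), g s(v, t) := by
    rw [HexObservableLimitR.greenLimit_sum_adj_eq_sum_black, Finset.mul_sum]
    refine Finset.sum_congr rfl fun v _ => ?_
    rw [Finset.mul_sum]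
    refine Finset.sum_congr rfl fun t _ => ?_
    rw [Sym2.eq_swap (a := t)]; ring
  -- (3) the up-oriented sum is dominated by the finsum over mid-edges
  have h3 : ∑ v ∈ Λ.filter (fun v => v.2 = 0), ∑ t ∈ Λ.filter (fun t => hexGraph.Adj v t), g s(v, t) ≤
      ∑ᶠ z ∈ {z : Sym2 HexVertex | z ∈ hexDomainMidEdges Λ ∧ (δ : ℂ) * hexMidpoint z ∈ K}, ‖Z z‖ := by
    have h := PickHalfPlane.Engine.sum_up_norm_le_finsum Λ Z δ K
    refine le_trans (le_of_eq ?_) h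
    refine Finset.sum_congr rfl fun v _ => ?_
    rw [filter_adj_eq_filter_nbrs]
  linarith [h1, h2, h3]

/-! ### 4. The dangling mass bound -/

/-- **Dangling masses are dominated by the star.** For a domain `Λ` rooted at the boundary dart
`{u, w}` (`u ∉ Λ ∋ w`) and a boundary dart `v → t` (`v ∈ Λ`, `t ∉ Λ`, `v ∼ t`) at a vertex `v ≠ w`:
`Z({v,t}) ≤ x_c · starMass(v)`.  Indeed a self-avoiding walk from the root to `{v,t}` ends at `v`
(not at `t ∉ Λ`), visits at least two vertices (it starts at `w ≠ v`), and dropping its last vertex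
leaves a walk, one step shorter, to the inner mid-edge `{y, v}` of the star of `v` through which it
arrived; this is injective. [cite: DuminilCopinSmirnov2012, §2 (walks between mid-edges)] -/
theorem norm_obs_zero_dart_le {Λ : Finset HexVertex} {u w v t : HexVertex} (hu : u ∉ Λ)
    (hv : v ∈ Λ) (ht : t ∉ Λ) (hvw : v ≠ w) :
    ‖hexParafermionicObservable Λ s(u, w) hexCriticalFugacity 0 s(v, t)‖ ≤
      hexCriticalFugacity * starMass Λ s(u, w) v := by
  classical
  set x : ℝ := hexCriticalFugacity with hx
  have hx0 : 0 ≤ x := hexCriticalFugacity_pos_lt_one.1.le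
  set A := HexMidEdgeSAW Λ s(u, w) s(v, t)
  -- structure of a walk to the dart
  have hne : ∀ γ : A, γ.verts ≠ [] := by
    intro γ h
    have he := γ.eq_of_nil h
    have hvmem : v ∈ s(u, w) := by rw [he]; exact Sym2.mem_mk_left _ _
    rcases Sym2.mem_iff.1 hvmem with h1 | h1
    · exact hu (h1 ▸ hv)
    · exact hvw h1
  have hlast : ∀ γ : A, γ.verts.getLast (hne γ) = v := by
    intro γ
    rcases γ.getLast_eq_or (hne γ) with h | h
    · exact h
    · exact absurd (h ▸ γ.subset _ (List.getLast_mem (hne γ))) ht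
  have hhead : ∀ γ : A, γ.verts.head (hne γ) = w := fun γ => γ.head_eq rfl hu (hne γ)
  have hverts : ∀ γ : A, γ.verts = γ.verts.dropLast ++ [v] := fun γ => by
    conv_lhs => rw [← List.dropLast_append_getLast (hne γ), hlast γ]
  have hPne : ∀ γ : A, γ.verts.dropLast ≠ [] := by
    intro γ hP
    have h1 : γ.verts = [v] := by rw [hverts γ, hP]; rfl
    have h2 := hhead γ
    simp only [h1, List.head_cons] at h2
    exact hvw h2
  -- the prefix walk
  have hcut : ∀ γ : A, ∃ y ∈ Λ.filter (fun y => hexGraph.Adj v y),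
      ∃ π : HexMidEdgeSAW Λ s(u, w) s(y, v), π.verts = γ.verts.dropLast := by
    intro γ
    set P := γ.verts.dropLast with hP
    set y := P.getLast (hPne γ) with hy
    obtain ⟨π, hπ, -⟩ := har_exists_cut γ (hverts γ) (hPne γ) (List.cons_ne_nil v []) hy.symm rfl
    have hyv : hexGraph.Adj y v := by
      have hc := γ.isChain
      rw [hverts γ] at hc
      exact hc.rel_getLast_head_of_append (hPne γ) (List.cons_ne_nil v [])
    have hyΛ : y ∈ Λ := γ.subset y (by rw [hverts γ]; exact List.mem_append_left _ (List.getLast_mem _))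
    exact ⟨y, Finset.mem_filter.2 ⟨hyΛ, hyv.symm⟩, π, hπ⟩
  -- sum over walks, re-indexed by the prefix list
  set f : A → List HexVertex := fun γ => γ.verts.dropLast with hf
  have hfinj : Set.InjOn f ↑(Finset.univ : Finset A) := by
    intro γ _ γ' _ h
    apply HexMidEdgeSAW.ext
    rw [hverts γ, hverts γ']
    simp only [hf] at h
    rw [h]
  have hlen : ∀ γ : A, γ.length = (f γ).length + 1 := fun γ => by
    simp only [HexMidEdgeSAW.length, hf]
    conv_lhs => rw [hverts γ]
    simp
  set B : Finset (List HexVertex) := (Λ.filter (fun y => hexGraph.Adj v y)).biUnion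
    (fun y => (Finset.univ : Finset (HexMidEdgeSAW Λ s(u, w) s(y, v))).image (fun π => π.verts)) with hB
  have himage : (Finset.univ : Finset A).image f ⊆ B := by
    intro l hl
    obtain ⟨γ, -, rfl⟩ := Finset.mem_image.1 hl
    obtain ⟨y, hy, π, hπ⟩ := hcut γ
    exact Finset.mem_biUnion.2 ⟨y, hy, Finset.mem_image.2 ⟨π, Finset.mem_univ _, hπ⟩⟩
  have hstar : ∀ y : HexVertex, ∑ l ∈ (Finset.univ : Finset (HexMidEdgeSAW Λ s(u, w) s(y, v))).image
      (fun π => π.verts), x ^ l.length =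
      ‖hexParafermionicObservable Λ s(u, w) hexCriticalFugacity 0 s(v, y)‖ := by
    intro y
    rw [Finset.sum_image (fun π _ π' _ h => HexMidEdgeSAW.ext h), Sym2.eq_swap (a := v), norm_Z_eq_sum _ _ _ hx0]
    rfl
  calc ‖hexParafermionicObservable Λ s(u, w) hexCriticalFugacity 0 s(v, t)‖
      = ∑ γ : A, x ^ γ.length := norm_Z_eq_sum _ _ _ hx0
    _ = ∑ γ : A, x * x ^ (f γ).length := Finset.sum_congr rfl fun γ _ => by rw [hlen γ, pow_succ]; ring
    _ = x * ∑ l ∈ (Finset.univ : Finset A).image f, x ^ l.length := by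
        rw [Finset.mul_sum, Finset.sum_image hfinj]
    _ ≤ x * ∑ l ∈ B, x ^ l.length :=
        mul_le_mul_of_nonneg_left (Finset.sum_le_sum_of_subset_of_nonneg himage
          fun _ _ _ => pow_nonneg hx0 _) hx0
    _ ≤ x * ∑ y ∈ Λ.filter (fun y => hexGraph.Adj v y),
          ∑ l ∈ (Finset.univ : Finset (HexMidEdgeSAW Λ s(u, w) s(y, v))).image (fun π => π.verts),
            x ^ l.length :=
        mul_le_mul_of_nonneg_left (sum_biUnion_le_sum_sum _ _ _ fun _ => pow_nonneg hx0 _) hx0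
    _ = x * starMass Λ s(u, w) v := by
        rw [starMass]
        congr 1
        exact Finset.sum_congr rfl fun y _ => hstar y

/-! ### 5. Splitting a vertex sum along a cover -/

/-- **Splitting along a cover.** If every vertex of `Λ` with property `A` lies in one of the pieces
`B i` (`i ∈ t`) or in `Tm`, then for non-negative `Φ`:
`Σ_{Λ, A} Φ ≤ Σ_{i ∈ t} Σ_{Λ, B i} Φ + Σ_{Λ, Tm} Φ`. [folklore] -/
theorem sum_filter_le_of_cover {ι : Type*} (Λ : Finset HexVertex) (t : Finset ι) (A Tm : HexVertex → Prop)
    (B : ι → HexVertex → Prop) [DecidablePred A] [DecidablePred Tm] [∀ i, DecidablePred (B i)]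
    (Φ : HexVertex → ℝ) (hΦ : ∀ v, 0 ≤ Φ v)
    (hsplit : ∀ v ∈ Λ, A v → (∃ i ∈ t, B i v) ∨ Tm v) :
    ∑ v ∈ Λ.filter A, Φ v ≤ ∑ i ∈ t, ∑ v ∈ Λ.filter (B i), Φ v + ∑ v ∈ Λ.filter Tm, Φ v := by
  classical
  have hsub : Λ.filter A ⊆ t.biUnion (fun i => Λ.filter (B i)) ∪ Λ.filter Tm := by
    intro v hv
    obtain ⟨hvΛ, hA⟩ := Finset.mem_filter.1 hv
    rcases hsplit v hvΛ hA with ⟨i, hi, hB⟩ | hT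
    · exact Finset.mem_union_left _ (Finset.mem_biUnion.2 ⟨i, hi, Finset.mem_filter.2 ⟨hvΛ, hB⟩⟩)
    · exact Finset.mem_union_right _ (Finset.mem_filter.2 ⟨hvΛ, hT⟩)
  calc ∑ v ∈ Λ.filter A, Φ v ≤ ∑ v ∈ t.biUnion (fun i => Λ.filter (B i)) ∪ Λ.filter Tm, Φ v :=
        Finset.sum_le_sum_of_subset_of_nonneg hsub fun v _ _ => hΦ v
    _ ≤ ∑ v ∈ t.biUnion (fun i => Λ.filter (B i)), Φ v + ∑ v ∈ Λ.filter Tm, Φ v :=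
        sum_union_le_add _ _ _ hΦ
    _ ≤ ∑ i ∈ t, ∑ v ∈ Λ.filter (B i), Φ v + ∑ v ∈ Λ.filter Tm, Φ v := by
        gcongr
        exact sum_biUnion_le_sum_sum _ _ _ hΦ

/-! ### Registered form (sub-goal of `polygonGreenPairing`) -/

/-- **Registered sub-goal `polygonGreen_layerCake`** (crux item stmt-CriticalPhenomena-14004, line
`polygon-parity-squeeze`, stub `polygonGreenPairing`, mechanism (A1a)): registry form (one `∀`-term) of
`layerCake_depth_le` — the layer-by-layer domination of a depth-weighted vertex functional over a budget
ball by the boundary layer budget. [cite: LawlerSchrammWerner2004SAW, §3.4 (restriction / boundary scaling heuristics)] -/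
theorem polygonGreen_layerCake : ∀ (Λ : Finset HexVertex) (a : Sym2 HexVertex) (δ r CB Zb : ℝ) (z : ℂ) (K : ℕ) (w : ℕ → ℝ) (Φ : HexVertex → ℝ), 0 ≤ δ → (∀ k : ℕ, δ * (∑ᶠ v ∈ {v : HexVertex | v ∈ Λ ∧ (δ : ℂ) * hexCenter v ∈ Metric.ball z r ∧ IsMetricDepth Λ v k}, starMass Λ a v) ≤ CB * ((k : ℝ) + 1) ^ (3 / 4 : ℝ) * Zb) → (∀ v ∈ Λ, ∀ k : ℕ, IsMetricDepth Λ v k → k ≤ K) → (∀ k, 0 ≤ w k) → (∀ v ∈ Λ, ∀ k : ℕ, IsMetricDepth Λ v k → Φ v ≤ w k * starMass Λ a v) → δ * ∑ v ∈ Λ.filter (fun v => (δ : ℂ) * hexCenter v ∈ Metric.ball z r), Φ v ≤ CB * Zb * ∑ k ∈ Finset.range (K + 1), w k * ((k : ℝ) + 1) ^ (3 / 4 : ℝ) :=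
  fun _ _ _ _ _ _ _ _ w Φ hδ hbudget hK hw hΦ => layerCake_depth_le hδ hbudget hK w hw Φ hΦ

end Summit.CriticalPhenomena.SAWScalingLimit.Theorems.PolygonParitySqueeze.PolygonGreen

end
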